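import Summits.Ventures.PercRepro.C026DirectAccess

/-!
# The capacity of a cluster class: `#{T : Com_c(T) = W} = τ(W) · 2^{e(V ∖ W)}` (p5, gen 15)

mine-3 (memo §28 (6), CONJECTURE M3-CL2X): the classes of the class-level (2×) are the possible open clusters
`W` of `c`, with capacity `#Y_a(W) = τ(W) · 2^{e(V ∖ W)}` — `τ(W)` the number of connected spanning subgraphs of
`G[W]` and `e(V ∖ W)` the number of edges with both ends outside `W`. This module proves the capacity formula:
a configuration with `Com_c(T) = W` has every boundary edge of `W` closed, its edges inside `W` form a connected
spanning subgraph (`spanCount W c`, counted as configurations supported inside `W` with `Com_c = W`), and its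
edges outside `W` are free.

* `Inside W e`, `Outside W e`; `spanCount`; **`card_cluster_eq`** — the factorisation; `card_outside_eq_pow` —
  the free part is `2^{e(V ∖ W)}`; **`card_cluster_eq_mul`** — the capacity formula; `card_cellAC_cluster_eq`
  — `#{T ∈ ac|b : Com_c(T) = W} = [a ∈ W, b ∉ W] · τ(W) · 2^{e(V ∖ W)}`.
-/

namespace PercRepro

open Finset

namespace MultiGraph

section ClassCapacity

variable {V E : Type*} (G : MultiGraph V E)

/-- An edge with both ends in `W`. -/
def Inside (W : Set V) (e : E) : Prop := G.fst e ∈ W ∧ G.snd e ∈ W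

/-- An edge with both ends outside `W`. -/
def Outside (W : Set V) (e : E) : Prop := G.fst e ∉ W ∧ G.snd e ∉ W

open Classical in
/-- mine-3's `τ(W)`: the configurations supported on the edges inside `W` whose open cluster of `c` is `W`
(the connected spanning subgraphs of `G[W]`). -/
noncomputable def spanCount [Fintype E] (W : Set V) (c : V) : ℕ :=
  (univ.filter fun ρ : Config E => (∀ e, ρ e = true → G.Inside W e) ∧ G.cluster ρ c = W).card

open Classical in
/-- The part of a configuration inside `W`. -/
noncomputable def insidePart (W : Set V) (ω : Config E) : Config E :=
  fun e => if G.Inside W e then ω e else false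

open Classical in
/-- The part of a configuration outside `W`. -/
noncomputable def outsidePart (W : Set V) (ω : Config E) : Config E :=
  fun e => if G.Outside W e then ω e else false

variable {G}

/-- An edge at a cluster that is open has both ends in it. -/
theorem inside_of_open_of_mem_edgesAt {ω : Config E} {c : V} {e : E} (he : ω e = true)
    (hmem : e ∈ G.edgesAt (G.cluster ω c)) : G.Inside (G.cluster ω c) e := by
  rcases hmem with h | h
  · exact ⟨h, G.snd_mem_cluster_of_open he h⟩
  · exact ⟨G.fst_mem_cluster_of_open he h, h⟩

/-- The inside part of a configuration with `Com_c = W` has the same cluster of `c`. -/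
theorem cluster_insidePart {ω : Config E} {c : V} {W : Set V} (h : G.cluster ω c = W) :
    G.cluster (G.insidePart W ω) c = W := by
  rw [← h]
  refine cluster_eq_of_agree ?_
  intro e he
  unfold insidePart
  by_cases hin : G.Inside (G.cluster ω c) e
  · rw [if_pos hin]
  · rw [if_neg hin]
    by_contra hne
    have hopen : ω e = true := by
      cases hωe : ω e
      · exact absurd hωe hne
      · rfl
    exact hin (inside_of_open_of_mem_edgesAt hopen he)

/-- A configuration with `Com_c = W` is the join of its inside and outside parts (its boundary edges are
closed). -/
theorem insidePart_sup_outsidePart {ω : Config E} {c : V} {W : Set V} (h : G.cluster ω c = W) :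
    G.insidePart W ω ⊔ G.outsidePart W ω = ω := by
  funext e
  rw [Pi.sup_apply]
  unfold insidePart outsidePart
  by_cases hin : G.Inside W e
  · have hout : ¬ G.Outside W e := fun hout => hout.1 hin.1
    rw [if_pos hin, if_neg hout]
    cases ω e <;> rfl
  · by_cases hout : G.Outside W e
    · rw [if_neg hin, if_pos hout]
      cases ω e <;> rfl
    · -- a boundary edge: closed
      rw [if_neg hin, if_neg hout]
      by_contra hne
      have hopen : ω e = true := by
        cases hωe : ω e
        · exact absurd hωe.symm (by simpa using hne)
        · rfl
      -- one end in `W`, the other outside: impossible for an open edge at the cluster `W`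
      have hfst : G.fst e ∈ W ∨ G.snd e ∈ W := by
        by_contra hno
        push Not at hno
        exact hout ⟨hno.1, hno.2⟩
      rw [← h] at hfst hin
      exact hin (inside_of_open_of_mem_edgesAt hopen hfst)

/-- The join of an inside-supported configuration with cluster `W` and an outside-supported one has cluster
`W`. -/
theorem cluster_sup_of_outside {ρ σ : Config E} {c : V} {W : Set V} (hρ : G.cluster ρ c = W)
    (hσ : ∀ e, σ e = true → G.Outside W e) : G.cluster (ρ ⊔ σ) c = W := by
  rw [← hρ]
  refine cluster_eq_of_agree ?_
  intro e he
  rw [Pi.sup_apply]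
  have hσe : σ e = false := by
    cases hσe : σ e
    · rfl
    · exfalso
      have hout := hσ e hσe
      rw [← hρ] at hout
      rcases he with h | h
      · exact hout.1 h
      · exact hout.2 h
  rw [hσe]
  cases ρ e <;> rfl

/-- The inside part of `ρ ⊔ σ` is `ρ` when `ρ` is supported inside and `σ` outside. -/
theorem insidePart_sup {ρ σ : Config E} {W : Set V} (hρ : ∀ e, ρ e = true → G.Inside W e)
    (hσ : ∀ e, σ e = true → G.Outside W e) : G.insidePart W (ρ ⊔ σ) = ρ := by
  funext e
  unfold insidePart
  rw [Pi.sup_apply]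
  by_cases hin : G.Inside W e
  · rw [if_pos hin]
    have : σ e = false := by
      cases hσe : σ e
      · rfl
      · exact absurd (hσ e hσe).1 (by simpa using hin.1)
    rw [this]
    cases ρ e <;> rfl
  · rw [if_neg hin]
    cases hρe : ρ e
    · rfl
    · exact absurd (hρ e hρe) hin

/-- The outside part of `ρ ⊔ σ` is `σ` when `ρ` is supported inside and `σ` outside. -/
theorem outsidePart_sup {ρ σ : Config E} {W : Set V} (hρ : ∀ e, ρ e = true → G.Inside W e)
    (hσ : ∀ e, σ e = true → G.Outside W e) : G.outsidePart W (ρ ⊔ σ) = σ := by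
  funext e
  unfold outsidePart
  rw [Pi.sup_apply]
  by_cases hout : G.Outside W e
  · rw [if_pos hout]
    have : ρ e = false := by
      cases hρe : ρ e
      · rfl
      · exact absurd (hρ e hρe).1 hout.1
    rw [this]
    cases σ e <;> rfl
  · rw [if_neg hout]
    cases hσe : σ e
    · rfl
    · exact absurd (hσ e hσe) hout

/-- The inside part is supported inside. -/
theorem insidePart_supported (W : Set V) (ω : Config E) :
    ∀ e, G.insidePart W ω e = true → G.Inside W e := by
  intro e he
  unfold insidePart at he
  by_contra hin
  rw [if_neg hin] at he
  exact Bool.false_ne_true he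

/-- The outside part is supported outside. -/
theorem outsidePart_supported (W : Set V) (ω : Config E) :
    ∀ e, G.outsidePart W ω e = true → G.Outside W e := by
  intro e he
  unfold outsidePart at he
  by_contra hout
  rw [if_neg hout] at he
  exact Bool.false_ne_true he

open Classical in
/-- **The factorisation**: `#{T : Com_c(T) = W} = τ(W) · #{σ supported outside W}`. -/
theorem card_cluster_eq [Fintype E] (W : Set V) (c : V) :
    (univ.filter fun ω : Config E => G.cluster ω c = W).card =
      G.spanCount W c * (univ.filter fun σ : Config E => ∀ e, σ e = true → G.Outside W e).card := by
  unfold spanCount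
  rw [← Finset.card_product]
  refine Finset.card_nbij' (fun ω => (G.insidePart W ω, G.outsidePart W ω))
    (fun p => p.1 ⊔ p.2) ?_ ?_ ?_ ?_
  · intro ω hω
    simp only [Finset.coe_filter, Finset.mem_univ, true_and, Set.mem_setOf_eq, Finset.coe_product,
      Set.mem_prod] at hω ⊢
    exact ⟨⟨insidePart_supported W ω, cluster_insidePart hω⟩, outsidePart_supported W ω⟩
  · intro p hp
    simp only [Finset.coe_filter, Finset.mem_univ, true_and, Set.mem_setOf_eq, Finset.coe_product,
      Set.mem_prod] at hp ⊢
    exact cluster_sup_of_outside hp.1.2 hp.2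
  · intro ω hω
    simp only [Finset.coe_filter, Finset.mem_univ, true_and, Set.mem_setOf_eq] at hω
    exact insidePart_sup_outsidePart hω
  · intro p hp
    simp only [Finset.coe_filter, Finset.mem_univ, true_and, Set.mem_setOf_eq, Finset.coe_product,
      Set.mem_prod] at hp
    show (G.insidePart W (p.1 ⊔ p.2), G.outsidePart W (p.1 ⊔ p.2)) = p
    rw [insidePart_sup hp.1.1 hp.2, outsidePart_sup hp.1.1 hp.2]

open Classical in
/-- **The free part**: the configurations supported outside `W` are `2^{e(V ∖ W)}`. -/
theorem card_outside_eq_pow [Fintype E] (W : Set V) :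
    (univ.filter fun σ : Config E => ∀ e, σ e = true → G.Outside W e).card =
      2 ^ (univ.filter fun e : E => G.Outside W e).card := by
  rw [← Fintype.card_subtype, ← Fintype.card_subtype, ← Fintype.card_bool, ← Fintype.card_fun]
  refine Fintype.card_congr
    { toFun := fun σ => fun e => σ.1 e.1
      invFun := fun f => ⟨fun e => if h : G.Outside W e then f ⟨e, h⟩ else false, ?_⟩
      left_inv := ?_
      right_inv := ?_ }
  · intro e he
    by_contra hout
    dsimp only at he
    rw [dif_neg hout] at he
    exact Bool.false_ne_true he
  · rintro ⟨σ, hσ⟩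
    ext e
    simp only
    by_cases hout : G.Outside W e
    · rw [dif_pos hout]
    · rw [dif_neg hout]
      cases hσe : σ e
      · rfl
      · exact absurd (hσ e hσe) hout
  · intro f
    funext ⟨e, he⟩
    simp only [dif_pos he]

open Classical in
/-- **The capacity formula** (mine-3 §28): `#{T : Com_c(T) = W} = τ(W) · 2^{e(V ∖ W)}`. -/
theorem card_cluster_eq_mul [Fintype E] (W : Set V) (c : V) :
    (univ.filter fun ω : Config E => G.cluster ω c = W).card =
      G.spanCount W c * 2 ^ (univ.filter fun e : E => G.Outside W e).card := by
  rw [card_cluster_eq, card_outside_eq_pow]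

open Classical in
/-- **The `a`-class capacity** `#Y_a(W) = #{T ∈ ac|b : Com_c(T) = W}`: `τ(W) · 2^{e(V ∖ W)}` when `a ∈ W` and
`b ∉ W`, and `0` otherwise. -/
theorem card_cellAC_cluster_eq [Fintype E] (W : Set V) (a b c : V) :
    (univ.filter fun ω : Config E =>
        (G.Conn ω c a ∧ ¬ G.Conn ω c b) ∧ G.cluster ω c = W).card =
      if a ∈ W ∧ b ∉ W then G.spanCount W c * 2 ^ (univ.filter fun e : E => G.Outside W e).card
        else 0 := by
  by_cases hab : a ∈ W ∧ b ∉ W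
  · rw [if_pos hab, ← card_cluster_eq_mul]
    congr 1
    refine Finset.filter_congr fun ω _ => ?_
    constructor
    · exact fun h => h.2
    · intro h
      refine ⟨⟨?_, ?_⟩, h⟩
      · have : a ∈ G.cluster ω c := by rw [h]; exact hab.1
        exact this
      · intro hcb
        have : b ∈ G.cluster ω c := hcb
        rw [h] at this
        exact hab.2 this
  · rw [if_neg hab, Finset.card_eq_zero, Finset.filter_eq_empty_iff]
    intro ω _ ⟨⟨hca, hcb⟩, hW⟩
    refine hab ⟨?_, ?_⟩
    · have : a ∈ G.cluster ω c := hca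
      rw [hW] at this
      exact this
    · intro hb
      have : b ∈ G.cluster ω c := by rw [hW]; exact hb
      exact hcb this

end ClassCapacity

end MultiGraph

end PercRepro
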